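import Literature.MathematicalPhysics.QuantumFieldTheory.Balaban1983to89.T4GaussianWhitening
import Literature.MathematicalPhysics.QuantumFieldTheory.Balaban1983to89.QGQInverse
import Literature.MathematicalPhysics.QuantumFieldTheory.Sweep1AreaLawProofs

/-!
# T4WhiteningFactor — the square-root-free (Gram) whitening factor `S = (BᵀB)⁻¹ Bᵀ`, its
row / column sums from coercivity + localisation of the precision, the NE1′ tower bound
with (W1) discharged into decay data, and (v1.1, §8) the (W2) cost of a quadratic remainder

(kernel-proved, `[folklore]`; finite `T⁴` bookkeeping for the NE1′ (O3b/H2) coupling line,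
rung (B)+1 of the Bałaban 1983–89 audit; NOT infinite volume, NOT a mass gap, NOT Clay.)

## Why this leaf (binder (W1) of MI-ES-W)

`T4GaussianWhitening` §7 left, per step `b` and history `h`, a WHITENING FACTOR `S_{b,h}` of the
Gaussian part of the one-step fluctuation law (the image of a product reference law under
`η ↦ m + S·e(η)`) together with the binder (W1): the absolute ROW sums `∑ᵢ |S l i| ≤ s_r` and
COLUMN sums `∑_l |S l i| ≤ s_c` of `S_{b,h}` bounded UNIFORMLY in `b`, `h`, the depth and the
volume (record `T4-EST-NE1p-P2.md` v1.21, MI-ES-W).  The textbook factor `S = C^{1/2}` (`C` the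
covariance; the choice in Dimock's expository account, from which `T4GaussianWhitening`'s
dictionary was drawn) is the wrong one here: a matrix square root is a spectral object whose
off-diagonal decay needs functional calculus (Demko–Moss–Smith type arguments), heavy to formalise
and foreign to the printed estimates, which are all stated for inverses of local operators.  The
observation of this file is that NO square root is needed when the PRECISION (inverse
covariance) is a GRAM operator `M = BᵀB` of a "first-order" operator `B : (raw sites Λ) →
(whitened sites ι)` — the generic shape of a Gaussian action `½‖Bξ‖² = ½ ∑ᵢ (∑_l B i l ξ_l)²`
built from local linear combinations of the field (covariant derivatives composed with a
linearised minimiser and a local elimination map, gauge-fixing rows, averaging rows …; which `B`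
print's fluctuation form has is ORIENTATION for the record, nothing of it is used or asserted
here).  Then, with `C := M⁻¹`,
* `S := C Bᵀ` satisfies `S Sᵀ = C Bᵀ B C = C` by pure algebra (§3) — so the standard Gaussian on
  `ℝ^ι` (MORE whitened coordinates than raw ones, in general) is pushed to the centred Gaussian
  with covariance `C` by `η ↦ Sη`, and `S B = 1` (a left inverse);
* the row sums of `|S|` are at most (row sums of `|C|`)·(column sums of `|B|`) and the column
  sums of `|S|` at most (column sums of `|C|`)·(row sums of `|B|`) (§1, §4): `B` is local, so its
  sums are trivially volume-free, and everything rests on the `ℓ¹–ℓ^∞` sums of the COVARIANCE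
  `C = M⁻¹` itself — never of a square root;
* those follow from exponential decay of the kernel of `C` plus a lattice-sum profile (§2), and
  the decay of `C = M⁻¹` follows from COERCIVITY of `M` plus exponential LOCALISATION of `M` by
  the finite Combes–Thomas argument ALREADY IN THE TREE, `QGQInverse.inverse_decay` (applied by
  name, §2); §2 also records the elementary conversion of an exponentially localised kernel
  `|M l l'| ≤ K e^{−δ d(l,l')}` into the `(e^{κd} − 1)`-weighted sums that theorem consumes, with
  the explicit smallness `K κ N₁ < γ`.
§5 assembles the volume-free constants `s_r = (γ − ρ)⁻¹ N β_c`, `s_c = (γ − ρ)⁻¹ N β_r`, and §6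
is the END-TO-END NE1′ tower bound of `T4GaussianWhitening` §7 with `S_{b,h} := (BᵀB)⁻¹Bᵀ` for a
displayed family `B_{b,h}` and (W1) REPLACED by: coercivity `γ` of `B_{b,h}ᵀ B_{b,h}`, its
`(e^{κ d_b} − 1)`-weighted row/column sums `≤ ρ < γ` for a pseudo-distance `d_b` on the raw sites
of level `b`, the profile `∑_{l'} e^{−κ d_b(l,l')} ≤ N`, and the row/column sums `β_r`, `β_c` of
`|B_{b,h}|` — all FREE of `b`, `h`, the depth and the volume, which is what makes the final
constant volume-free.

After this leaf the analysis inputs of the NE1′ coupling line on the tensorisation side read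
(record v1.22, MI-ES-W′): (W0) identification of the small-field one-step law with the Gibbs
image under `T_{b,h} ∘ (m_{b,h} + (BᵀB)⁻¹Bᵀ · e(·))`; (W1′) coercivity and exponential
localisation of the Gram precision `B_{b,h}ᵀ B_{b,h}` and locality of `B_{b,h}`, uniformly;
(W2), (W3), the raw graded sensitivities and the graded-geometric profile — unchanged.  Where
(W1′) comes from for the printed fluctuation form (positivity of the fluctuation covariance,
decay of the linearised minimiser / background-field propagators, finite range of the
elimination and averaging maps) is LOCATED in the record, not proved, not cited and not
asserted here.

## Contents

§1 row / column sums of `|A B|` from those of `|A|`, `|B|` · §2 row / column sums of an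
exponentially decaying kernel from a lattice-sum profile; row / column sums of `|M⁻¹|` from
coercivity + weighted localisation of `M` (`QGQInverse.inverse_decay`); weighted localisation
from plain exponential localisation (the calculus step `e^t − 1 ≤ t e^t` is the tree's
`AreaLaw.exp_sub_one_le_mul_exp`, imported, not restated) · §3 the Gram whitening factor
`whiteningFactor B = (BᵀB)⁻¹Bᵀ`: `S B = 1`, `S Sᵀ = (BᵀB)⁻¹` · §4 its row / column sums · §5 the
volume-free constants from (coercivity, localisation, profile, locality of `B`) · §6 the NE1′
tower bound `integral_sq_sub_towerMean_le_of_graded_geometric_gramWhitenedGibbs_boxed_pathLaw`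
· §7 the dictionary theorem behind (W0): `η ↦ m + Sη` pushes the product of standard one-dimensional
Gaussians on the whitened sites to Mathlib's `multivariateGaussian` with mean `m` and covariance
`(BᵀB)⁻¹` on the raw sites (`map_pi_gaussianReal_affine_whiteningFactor`; characterisation of
Gaussian measures by mean and covariance, `S Sᵀ = (BᵀB)⁻¹`) · §8 (v1.1) interactions in
whitened coordinates: the (W2) format (mixed second differences between distinct whitened sites)
is subadditive in the interaction, and for a QUADRATIC raw-field functional `u ↦ ½⟨u, Q u⟩` read
through `u = affine m S e η` the mixed second differences are EXACTLY
`−½ (Δe_j)(Δe_i) ((SᵀQS) j i + (SᵀQS) i j)`, hence `≤ 2p² (|(SᵀQS) j i| + |(SᵀQS) i j|)` for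
readings `|e| ≤ p`, with row sums `≤ 2p² · s_r s_c · (q_r + q_c)` (`q_r`, `q_c` the row / column
sums of `|Q|`) — the explicit additive cost in `α₀` of carrying a quadratic remainder of the
precision (the part that is not of Gram form) inside the interaction rather than inside `B`.

## Honest flags

* `[folklore]` throughout: finite sums, matrix algebra over `ℝ`, one application of the tree's
  finite Combes–Thomas theorem, and (§7) Mathlib's characterisation of finite-dimensional Gaussian
  measures by mean and covariance; 0 citations.  The physics dictionary above (Gram form of the
  fluctuation action, which operators enter `B`) is ORIENTATION for the record `T4-EST-NE1p-P2.md`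
  and is neither used nor asserted in any declaration.
* Nothing printed is reproduced or claimed: coercivity, localisation, the profile and the
  locality of `B` are DISPLAYED hypotheses of §5–§6, to be discharged (or not) from print by the
  record's located pointers; BetaPertH / (B) / (B^μ) are untouched and appear nowhere.
* Finite `T⁴`, finitely many raw and whitened sites; the small-field format of
  `T4GaussianWhitening` §7 (bounded energy, boxed product reference law) is inherited verbatim.
-/

noncomputable section

open MeasureTheory ProbabilityTheory Finset Function Matrix
open scoped ENNReal

namespace Literature.MathematicalPhysics.QuantumFieldTheory.Balaban1983to89.T4WhiteningFactor

open Literature.MathematicalPhysics.QuantumFieldTheory.Balaban1983to89.T4CouplingChain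
open Literature.MathematicalPhysics.QuantumFieldTheory.Balaban1983to89.T4CouplingIncoherence
open Literature.MathematicalPhysics.QuantumFieldTheory.Balaban1983to89.T4DobrushinTensorisation
open Literature.MathematicalPhysics.QuantumFieldTheory.Balaban1983to89.T4GaussianWhitening
open Literature.MathematicalPhysics.QuantumFieldTheory.Balaban1983to89.QGQInverse

universe u v w

/-! ## §1 Row and column sums of a product -/

section Sums

variable {m : Type*} {n : Type*} {p : Type*} [Fintype n] [Fintype p]

omit [Fintype p] in
/-- `[folklore]` `|∑ᵢ A l i · B i j| ≤ ∑ᵢ |A l i| · |B i j|`. -/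
theorem abs_mul_apply_le (A : Matrix m n ℝ) (B : Matrix n p ℝ) (l : m) (j : p) :
    |(A * B) l j| ≤ ∑ i, |A l i| * |B i j| := by
  rw [Matrix.mul_apply]
  refine (Finset.abs_sum_le_sum_abs _ _).trans (le_of_eq ?_)
  exact Finset.sum_congr rfl fun i _ => abs_mul _ _

/-- `[folklore]` **Row sums of a product**: `∑ⱼ |(AB) l j| ≤ a · b` when the row sums of `|A|`
are `≤ a` and the row sums of `|B|` are `≤ b` (`0 ≤ b`). -/
theorem rowSum_mul_le (A : Matrix m n ℝ) (B : Matrix n p ℝ) {a b : ℝ} (hb : 0 ≤ b)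
    (hA : ∀ l, ∑ i, |A l i| ≤ a) (hB : ∀ i, ∑ j, |B i j| ≤ b) (l : m) :
    ∑ j, |(A * B) l j| ≤ a * b := by
  calc ∑ j, |(A * B) l j| ≤ ∑ j, ∑ i, |A l i| * |B i j| :=
        Finset.sum_le_sum fun j _ => abs_mul_apply_le A B l j
    _ = ∑ i, |A l i| * ∑ j, |B i j| := by
        rw [Finset.sum_comm]
        exact Finset.sum_congr rfl fun i _ => (Finset.mul_sum _ _ _).symm
    _ ≤ ∑ i, |A l i| * b :=
        Finset.sum_le_sum fun i _ => mul_le_mul_of_nonneg_left (hB i) (abs_nonneg _)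
    _ = (∑ i, |A l i|) * b := (Finset.sum_mul _ _ _).symm
    _ ≤ a * b := mul_le_mul_of_nonneg_right (hA l) hb

omit [Fintype p] in
/-- `[folklore]` **Column sums of a product**: `∑_l |(AB) l j| ≤ a · b` when the column sums of
`|A|` are `≤ a` (`0 ≤ a`) and the column sums of `|B|` are `≤ b`. -/
theorem colSum_mul_le [Fintype m] (A : Matrix m n ℝ) (B : Matrix n p ℝ) {a b : ℝ} (ha : 0 ≤ a)
    (hA : ∀ i, ∑ l, |A l i| ≤ a) (hB : ∀ j, ∑ i, |B i j| ≤ b) (j : p) :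
    ∑ l, |(A * B) l j| ≤ a * b := by
  calc ∑ l, |(A * B) l j| ≤ ∑ l, ∑ i, |A l i| * |B i j| :=
        Finset.sum_le_sum fun l _ => abs_mul_apply_le A B l j
    _ = ∑ i, (∑ l, |A l i|) * |B i j| := by
        rw [Finset.sum_comm]
        exact Finset.sum_congr rfl fun i _ => (Finset.sum_mul _ _ _).symm
    _ ≤ ∑ i, a * |B i j| :=
        Finset.sum_le_sum fun i _ => mul_le_mul_of_nonneg_right (hA i) (abs_nonneg _)
    _ = a * ∑ i, |B i j| := (Finset.mul_sum _ _ _).symm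
    _ ≤ a * b := mul_le_mul_of_nonneg_left (hB j) ha

omit [Fintype n] in
/-- `[folklore]` Row sums of `|Aᵀ|` are the column sums of `|A|`. -/
theorem sum_abs_transpose_apply [Fintype m] (A : Matrix m n ℝ) (i : n) :
    ∑ l, |Aᵀ i l| = ∑ l, |A l i| := by
  simp only [Matrix.transpose_apply]

end Sums

/-! ## §2 Row / column sums from exponential decay; the inverse of a coercive localised matrix -/

section Decay

variable {n : Type*} [Fintype n]

/-- `[folklore]` **Decay + profile ⇒ row sums.**  `|C x y| ≤ K · w x y` and `∑_y w x y ≤ N`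
(`0 ≤ K`) give `∑_y |C x y| ≤ K · N`.  Typically `w x y = e^{−κ d(x,y)}` and `N` is the
lattice-sum profile `sup_x ∑_y e^{−κ d(x,y)}` — volume-free on every lattice / torus of fixed
dimension (`B4Sect5Torus.SumBound`, `B6RandomWalk.Ineq261` are the tree's named shapes). -/
theorem rowSum_le_of_decay (C : Matrix n n ℝ) (w : n → n → ℝ) {K N : ℝ} (hK : 0 ≤ K)
    (hC : ∀ x y, |C x y| ≤ K * w x y) (hw : ∀ x, ∑ y, w x y ≤ N) (x : n) :
    ∑ y, |C x y| ≤ K * N :=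
  calc ∑ y, |C x y| ≤ ∑ y, K * w x y := Finset.sum_le_sum fun y _ => hC x y
    _ = K * ∑ y, w x y := (Finset.mul_sum _ _ _).symm
    _ ≤ K * N := mul_le_mul_of_nonneg_left (hw x) hK

/-- `[folklore]` **Decay + profile ⇒ column sums** (symmetric weight). -/
theorem colSum_le_of_decay (C : Matrix n n ℝ) (w : n → n → ℝ) {K N : ℝ} (hK : 0 ≤ K)
    (hC : ∀ x y, |C x y| ≤ K * w x y) (hw_symm : ∀ x y, w x y = w y x)
    (hw : ∀ x, ∑ y, w x y ≤ N) (y : n) : ∑ x, |C x y| ≤ K * N :=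
  calc ∑ x, |C x y| ≤ ∑ x, K * w x y := Finset.sum_le_sum fun x _ => hC x y
    _ = K * ∑ x, w y x := by
        rw [Finset.mul_sum]; exact Finset.sum_congr rfl fun x _ => by rw [hw_symm]
    _ ≤ K * N := mul_le_mul_of_nonneg_left (hw y) hK

variable [DecidableEq n]

/-- `[folklore]` **Row and column sums of the inverse of a coercive, exponentially localised
matrix.**  `M` coercive with constant `γ`; `d` a pseudo-distance on the index set; the
`(e^{κd} − 1)`-weighted absolute row and column sums of `M` are `≤ ρ < γ` (`0 ≤ κ`); and the
profile `∑_y e^{−κ d(x,y)} ≤ N`.  Then every row sum and every column sum of `|M⁻¹|` is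
`≤ (γ − ρ)⁻¹ · N`.  The decay of `M⁻¹` is the tree's finite Combes–Thomas theorem
`QGQInverse.inverse_decay`, applied by name. -/
theorem inv_sums_le_of_coercive_localised (M : Matrix n n ℝ) (d : n → n → ℝ) {γ κ ρ N : ℝ}
    (hργ : ρ < γ) (hκ : 0 ≤ κ) (hM : Coercive M γ)
    (hd_symm : ∀ i j, d i j = d j i) (hd_zero : ∀ i, d i i = 0)
    (hd_tri : ∀ i j k, d i k ≤ d i j + d j k)
    (hrow : ∀ i, ∑ j, |M i j| * (Real.exp (κ * d i j) - 1) ≤ ρ)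
    (hcol : ∀ j, ∑ i, |M i j| * (Real.exp (κ * d i j) - 1) ≤ ρ)
    (hN : ∀ x, ∑ y, Real.exp (-(κ * d x y)) ≤ N) :
    (∀ x, ∑ y, |M⁻¹ x y| ≤ (γ - ρ)⁻¹ * N) ∧ (∀ y, ∑ x, |M⁻¹ x y| ≤ (γ - ρ)⁻¹ * N) := by
  have hdec : ∀ x y, |M⁻¹ x y| ≤ (γ - ρ)⁻¹ * Real.exp (-(κ * d x y)) :=
    fun x y => inverse_decay M d hργ hκ hM hd_symm hd_zero hd_tri hrow hcol x y
  have hK : 0 ≤ (γ - ρ)⁻¹ := inv_nonneg.mpr (by linarith)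
  have hw_symm : ∀ x y, Real.exp (-(κ * d x y)) = Real.exp (-(κ * d y x)) :=
    fun x y => by rw [hd_symm]
  exact ⟨rowSum_le_of_decay M⁻¹ _ hK hdec hN, colSum_le_of_decay M⁻¹ _ hK hdec hw_symm hN⟩

omit [DecidableEq n] in
/-- `[folklore]` **Plain exponential localisation ⇒ weighted localisation.**  If
`|M i j| ≤ K e^{−δ d(i,j)}` (`0 ≤ K`, `0 ≤ d`), then for every rate `0 ≤ κ` the
`(e^{κd} − 1)`-weighted row sum is at most `K κ · ∑ⱼ d(i,j) e^{−(δ−κ) d(i,j)}`; so with the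
first-moment profile `∑ⱼ d(i,j) e^{−(δ−κ) d(i,j)} ≤ N₁` it is `≤ K κ N₁`, which is `< γ` for
`κ` small — the usual choice of the Combes–Thomas rate.  (Columns: the same with `d` symmetric
and the bound on `|M i j|` read transposed.) -/
theorem weightedRowSum_le_of_expDecay (M : Matrix n n ℝ) (d : n → n → ℝ) {K δ κ N₁ : ℝ}
    (hK : 0 ≤ K) (hκ : 0 ≤ κ) (hd0 : ∀ i j, 0 ≤ d i j)
    (hM : ∀ i j, |M i j| ≤ K * Real.exp (-(δ * d i j)))
    (hN₁ : ∀ i, ∑ j, d i j * Real.exp (-((δ - κ) * d i j)) ≤ N₁) (i : n) :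
    ∑ j, |M i j| * (Real.exp (κ * d i j) - 1) ≤ K * κ * N₁ := by
  have hterm : ∀ j, |M i j| * (Real.exp (κ * d i j) - 1) ≤
      K * κ * (d i j * Real.exp (-((δ - κ) * d i j))) := by
    intro j
    have hw0 : 0 ≤ Real.exp (κ * d i j) - 1 := by
      have := Real.exp_le_exp.mpr (mul_nonneg hκ (hd0 i j))
      rw [Real.exp_zero] at this; linarith
    have hw1 : Real.exp (κ * d i j) - 1 ≤ κ * d i j * Real.exp (κ * d i j) :=
      AreaLaw.exp_sub_one_le_mul_exp _
    calc |M i j| * (Real.exp (κ * d i j) - 1)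
        ≤ K * Real.exp (-(δ * d i j)) * (κ * d i j * Real.exp (κ * d i j)) :=
          mul_le_mul (hM i j) hw1 hw0 (mul_nonneg hK (Real.exp_pos _).le)
      _ = K * κ * (d i j * Real.exp (-((δ - κ) * d i j))) := by
          have : Real.exp (-((δ - κ) * d i j)) = Real.exp (-(δ * d i j)) * Real.exp (κ * d i j) := by
            rw [← Real.exp_add]; ring_nf
          rw [this]; ring
  calc ∑ j, |M i j| * (Real.exp (κ * d i j) - 1)
      ≤ ∑ j, K * κ * (d i j * Real.exp (-((δ - κ) * d i j))) := Finset.sum_le_sum fun j _ => hterm j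
    _ = K * κ * ∑ j, d i j * Real.exp (-((δ - κ) * d i j)) := (Finset.mul_sum _ _ _).symm
    _ ≤ K * κ * N₁ := mul_le_mul_of_nonneg_left (hN₁ i) (mul_nonneg hK hκ)

omit [DecidableEq n] in
/-- `[folklore]` Column version of `weightedRowSum_le_of_expDecay` (symmetric `d`). -/
theorem weightedColSum_le_of_expDecay (M : Matrix n n ℝ) (d : n → n → ℝ) {K δ κ N₁ : ℝ}
    (hK : 0 ≤ K) (hκ : 0 ≤ κ) (hd0 : ∀ i j, 0 ≤ d i j) (hd_symm : ∀ i j, d i j = d j i)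
    (hM : ∀ i j, |M i j| ≤ K * Real.exp (-(δ * d i j)))
    (hN₁ : ∀ i, ∑ j, d i j * Real.exp (-((δ - κ) * d i j)) ≤ N₁) (j : n) :
    ∑ i, |M i j| * (Real.exp (κ * d i j) - 1) ≤ K * κ * N₁ := by
  have h := weightedRowSum_le_of_expDecay Mᵀ d hK hκ hd0
    (fun i j => by rw [Matrix.transpose_apply, hd_symm]; exact hM j i) hN₁ j
  simpa only [Matrix.transpose_apply, hd_symm j] using h

end Decay

/-! ## §3 The Gram whitening factor -/

section Gram

variable {Λ : Type w} {ι : Type u} [Fintype Λ] [Fintype ι] [DecidableEq Λ]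

/-- `[folklore]` **The Gram whitening factor** of a "first-order" operator `B` from the raw sites
`Λ` to the whitened sites `ι`: `S := (BᵀB)⁻¹ Bᵀ : Λ × ι → ℝ` (`⁻¹` = `Matrix.nonsing_inv`, the
genuine inverse as soon as `BᵀB` is invertible, e.g. coercive). -/
def whiteningFactor (B : Matrix ι Λ ℝ) : Matrix Λ ι ℝ := (Bᵀ * B)⁻¹ * Bᵀ

omit [Fintype Λ] [DecidableEq Λ] in
/-- `[folklore]` The Gram precision `BᵀB` is symmetric. -/
theorem isSymm_transpose_mul_self (B : Matrix ι Λ ℝ) : (Bᵀ * B).IsSymm := by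
  unfold Matrix.IsSymm
  rw [Matrix.transpose_mul, Matrix.transpose_transpose]

/-- `[folklore]` The inverse of a symmetric matrix is symmetric. -/
theorem isSymm_inv_of_isSymm {M : Matrix Λ Λ ℝ} (h : M.IsSymm) : M⁻¹.IsSymm := by
  unfold Matrix.IsSymm at h ⊢
  rw [Matrix.transpose_nonsing_inv, h]

/-- `[folklore]` `Sᵀ = B (BᵀB)⁻¹`. -/
theorem transpose_whiteningFactor (B : Matrix ι Λ ℝ) :
    (whiteningFactor B)ᵀ = B * (Bᵀ * B)⁻¹ := by
  rw [whiteningFactor, Matrix.transpose_mul, Matrix.transpose_transpose,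
    (isSymm_inv_of_isSymm (isSymm_transpose_mul_self B)).eq]

/-- `[folklore]` **`S` is a left inverse of `B`**: `(BᵀB)⁻¹Bᵀ · B = 1` when `BᵀB` is
invertible. -/
theorem whiteningFactor_mul_self (B : Matrix ι Λ ℝ) (h : IsUnit (Bᵀ * B).det) :
    whiteningFactor B * B = 1 := by
  rw [whiteningFactor, Matrix.mul_assoc, Matrix.nonsing_inv_mul _ h]

/-- `[folklore]` **THE WHITENING IDENTITY** `S Sᵀ = (BᵀB)⁻¹`: the covariance of `S η` for a
standard (identity-covariance) `η` on the whitened sites is the inverse Gram precision — no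
square root taken. -/
theorem whiteningFactor_mul_transpose (B : Matrix ι Λ ℝ) (h : IsUnit (Bᵀ * B).det) :
    whiteningFactor B * (whiteningFactor B)ᵀ = (Bᵀ * B)⁻¹ := by
  rw [transpose_whiteningFactor, whiteningFactor, Matrix.mul_assoc, ← Matrix.mul_assoc Bᵀ,
    Matrix.mul_nonsing_inv _ h, Matrix.mul_one]

/-- `[folklore]` Entrywise form of the whitening identity:
`∑ᵢ S l i · S l' i = (BᵀB)⁻¹ l l'`. -/
theorem sum_whiteningFactor_mul (B : Matrix ι Λ ℝ) (h : IsUnit (Bᵀ * B).det) (l l' : Λ) :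
    ∑ i, whiteningFactor B l i * whiteningFactor B l' i = (Bᵀ * B)⁻¹ l l' := by
  have := congrFun (congrFun (whiteningFactor_mul_transpose B h) l) l'
  rw [Matrix.mul_apply] at this
  simpa only [Matrix.transpose_apply] using this

/-- `[folklore]` A coercive Gram precision (`γ > 0`) is invertible. -/
theorem isUnit_det_of_coercive {M : Matrix Λ Λ ℝ} {γ : ℝ} (hγ : 0 < γ) (hM : Coercive M γ) :
    IsUnit M.det :=
  (Matrix.isUnit_iff_isUnit_det M).mp (isUnit_of_coercive hγ hM)

omit [DecidableEq Λ] in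
/-- `[folklore]` Coercivity of the Gram precision is the lower bound `γ‖ξ‖² ≤ ‖Bξ‖²`. -/
theorem coercive_transpose_mul_self_iff (B : Matrix ι Λ ℝ) (γ : ℝ) :
    Coercive (Bᵀ * B) γ ↔ ∀ ξ : Λ → ℝ, γ * (ξ ⬝ᵥ ξ) ≤ (B *ᵥ ξ) ⬝ᵥ (B *ᵥ ξ) := by
  refine forall_congr' fun ξ => ?_
  rw [← Matrix.mulVec_mulVec, Matrix.dotProduct_mulVec, Matrix.vecMul_transpose]

/-- `[folklore]` Non-vacuity: for the identity "first-order operator" (`ι = Λ`, `B = 1`) the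
whitening factor is the identity … -/
example : whiteningFactor (1 : Matrix Λ Λ ℝ) = 1 := by
  simp [whiteningFactor]

omit [DecidableEq Λ] in
/-- `[folklore]` … and its Gram precision is coercive with constant `1`. -/
example : Coercive ((1 : Matrix Λ Λ ℝ)ᵀ * 1) 1 := by
  intro ξ
  simp [Matrix.transpose_one, Matrix.one_mulVec]

end Gram

/-! ## §4 Row and column sums of the whitening factor -/

section GramSums

variable {Λ : Type w} {ι : Type u} [Fintype Λ] [Fintype ι] [DecidableEq Λ]

/-- `[folklore]` **Row sums of `S = (BᵀB)⁻¹Bᵀ`** ≤ (row sums of `|(BᵀB)⁻¹|`) · (column sums of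
`|B|`). -/
theorem rowSum_whiteningFactor_le (B : Matrix ι Λ ℝ) {cC βc : ℝ} (hβc : 0 ≤ βc)
    (hC : ∀ l, ∑ l', |(Bᵀ * B)⁻¹ l l'| ≤ cC) (hBc : ∀ l, ∑ i, |B i l| ≤ βc) (l : Λ) :
    ∑ i, |whiteningFactor B l i| ≤ cC * βc :=
  rowSum_mul_le _ _ hβc hC (fun l' => by rw [sum_abs_transpose_apply]; exact hBc l') l

/-- `[folklore]` **Column sums of `S = (BᵀB)⁻¹Bᵀ`** ≤ (column sums of `|(BᵀB)⁻¹|`) · (row sums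
of `|B|`). -/
theorem colSum_whiteningFactor_le (B : Matrix ι Λ ℝ) {cC βr : ℝ} (hcC : 0 ≤ cC)
    (hC : ∀ l', ∑ l, |(Bᵀ * B)⁻¹ l l'| ≤ cC) (hBr : ∀ i, ∑ l, |B i l| ≤ βr) (i : ι) :
    ∑ l, |whiteningFactor B l i| ≤ cC * βr :=
  colSum_mul_le _ _ hcC hC (fun i => by simpa only [Matrix.transpose_apply] using hBr i) i

end GramSums

/-! ## §5 The volume-free constants from coercivity, localisation, profile and locality -/

section Constants

variable {Λ : Type w} {ι : Type u} [Fintype Λ] [Fintype ι] [DecidableEq Λ]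

/-- `[folklore]` **(W1) FROM DECAY DATA.**  Let `B : ι × Λ → ℝ` with Gram precision `M = BᵀB`
coercive (`γ`), `d` a pseudo-distance on `Λ`, the `(e^{κd} − 1)`-weighted row and column sums of
`M` at most `ρ < γ` (`0 ≤ κ`), the profile `∑_{l'} e^{−κ d(l,l')} ≤ N`, and `|B|` with row sums
`≤ β_r` and column sums `≤ β_c` (`0 ≤ β_c`).  Then the whitening factor `S = M⁻¹Bᵀ` has
row sums `≤ (γ − ρ)⁻¹ N β_c` and column sums `≤ (γ − ρ)⁻¹ N β_r`. -/
theorem whiteningFactor_sums_le (B : Matrix ι Λ ℝ) (d : Λ → Λ → ℝ) {γ κ ρ N βr βc : ℝ}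
    (hργ : ρ < γ) (hκ : 0 ≤ κ) (hM : Coercive (Bᵀ * B) γ)
    (hd_symm : ∀ i j, d i j = d j i) (hd_zero : ∀ i, d i i = 0)
    (hd_tri : ∀ i j k, d i k ≤ d i j + d j k)
    (hrow : ∀ i, ∑ j, |(Bᵀ * B) i j| * (Real.exp (κ * d i j) - 1) ≤ ρ)
    (hcol : ∀ j, ∑ i, |(Bᵀ * B) i j| * (Real.exp (κ * d i j) - 1) ≤ ρ)
    (hN0 : 0 ≤ N) (hN : ∀ l, ∑ l', Real.exp (-(κ * d l l')) ≤ N)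
    (hBr : ∀ i, ∑ l, |B i l| ≤ βr) (hβc : 0 ≤ βc) (hBc : ∀ l, ∑ i, |B i l| ≤ βc) :
    (∀ l, ∑ i, |whiteningFactor B l i| ≤ (γ - ρ)⁻¹ * N * βc) ∧
      (∀ i, ∑ l, |whiteningFactor B l i| ≤ (γ - ρ)⁻¹ * N * βr) := by
  obtain ⟨hr, hc⟩ :=
    inv_sums_le_of_coercive_localised (Bᵀ * B) d hργ hκ hM hd_symm hd_zero hd_tri hrow hcol hN
  have hK : 0 ≤ (γ - ρ)⁻¹ * N := mul_nonneg (inv_nonneg.mpr (by linarith)) hN0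
  exact ⟨rowSum_whiteningFactor_le B hβc hr hBc, colSum_whiteningFactor_le B hK hc hBr⟩

end Constants

/-! ## §6 The NE1′ tower bound with the Gram whitening factor and (W1) from decay data -/

section EndToEnd

open Preorder MeasureTheory.Filtration

variable {X : ℕ → Type*} [∀ n, MeasurableSpace (X n)]

open scoped Classical in
/-- `[folklore]` **NE1′ TOWER BOUND, GRAM-WHITENED GIBBS FORM, (W1) FROM DECAY DATA.**  This is
`T4GaussianWhitening.integral_sq_sub_towerMean_le_of_graded_geometric_whitenedGibbs_boxed_pathLaw`
with the whitening factor SPECIALISED to the Gram factor `S_{b,h} := (B_{b,h}ᵀ B_{b,h})⁻¹ B_{b,h}ᵀ`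
of a displayed family of first-order operators `B_{b,h} : ι_b × Λ_b → ℝ`, and its binder (W1)
(uniform row / column sums of `|S_{b,h}|`) REPLACED by decay data, per step `b < n` and history
`h`: coercivity `γ` of the Gram precision `B_{b,h}ᵀ B_{b,h}`; its `(e^{κ d_b} − 1)`-weighted
absolute row and column sums `≤ ρ < γ` for a pseudo-distance `d_b` on the raw sites of level `b`
and a rate `κ ≥ 0`; the lattice-sum profile `∑_{l'} e^{−κ d_b(l,l')} ≤ N`; and the row sums
`≤ β_r` / column sums `≤ β_c` of `|B_{b,h}|` — the six numbers `γ, ρ, κ, N, β_r, β_c` FREE of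
`b`, `h`, the depth and the volume.  Conclusion: the tower bound with
`s_r s_c = ((γ − ρ)⁻¹ N β_c) · ((γ − ρ)⁻¹ N β_r)`.  Every other binder — the path law `μ` with
its disintegration kernels, the whitened Gibbs representation (W0) `hrep`, (W2) `hδ0 hδ hα₀ hrowδ`,
(W3) `hω`, the boxed product reference law, the raw Lipschitz vectors on raw boxes containing the
image of the whitened configurations, the graded-geometric profile — is passed VERBATIM. -/
theorem integral_sq_sub_towerMean_le_of_graded_geometric_gramWhitenedGibbs_boxed_pathLaw
    (μ : Measure (Π n, X n)) [IsFiniteMeasure μ]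
    (κ' : (b : ℕ) → Kernel (Π i : Iic b, X i) (X (b + 1))) [∀ b, IsMarkovKernel (κ' b)]
    (hκ' : ∀ b, μ.map (frestrictLe b) ⊗ₘ κ' b = μ.map (fun x => (frestrictLe b x, x (b + 1))))
    (n : ℕ) {φ : (Π k, X k) → ℝ} (hφn : StronglyMeasurable[piLE (X := X) n] φ) {R : ℝ}
    (hφR : ∀ x, |φ x| ≤ R)
    {Λ : ℕ → Type w} [∀ b, Fintype (Λ b)] [∀ b, DecidableEq (Λ b)]
    {ι : ℕ → Type u} [∀ b, Fintype (ι b)] [∀ b, DecidableEq (ι b)] {E : (b : ℕ) → ι b → Type v}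
    [∀ b i, MeasurableSpace (E b i)]
    {T : (b : ℕ) → (Π i : Iic b, X i) → (Λ b → ℝ) → X (b + 1)} (hT : ∀ b h, Measurable (T b h))
    (m : (b : ℕ) → (Π i : Iic b, X i) → Λ b → ℝ)
    (Bm : (b : ℕ) → (Π i : Iic b, X i) → Matrix (ι b) (Λ b) ℝ)
    {e : (b : ℕ) → (i : ι b) → E b i → ℝ} (he : ∀ b i, Measurable (e b i))
    {p : ℕ → ℝ} (hep : ∀ b i x, |e b i x| ≤ p b)
    (π : (b : ℕ) → (Π i : Iic b, X i) → (i : ι b) → Measure (E b i))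
    [∀ b h i, IsProbabilityMeasure (π b h i)] {v : ℝ} (hv0 : 0 ≤ v)
    (hv : ∀ b h i, ∫ y, e b i y ^ 2 ∂(π b h i) ≤ v)
    (A : (b : ℕ) → (Π i : Iic b, X i) → ((i : ι b) → E b i) → ℝ)
    (hAm : ∀ b h, Measurable (A b h)) {a : (b : ℕ) → (Π i : Iic b, X i) → ℝ}
    (hAb : ∀ b h η, |A b h η| ≤ a b h)
    (hrep : ∀ b < n, ∀ h, κ' b h =
      (gibbsMeasure (π b h) (A b h)).map
        (fun η => T b h (affine (m b h) (whiteningFactor (Bm b h)) (e b) η)))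
    {δ : (b : ℕ) → (Π i : Iic b, X i) → ι b → ι b → ℝ} (hδ0 : ∀ b h i j, 0 ≤ δ b h i j)
    (hδ : ∀ b h (i j : ι b), j ≠ i → ∀ (ξ : (k : ι b) → E b k) (y y' : E b j) (z z' : E b i),
      (A b h (update (update ξ j y') i z) - A b h (update (update ξ j y) i z)) -
        (A b h (update (update ξ j y') i z') - A b h (update (update ξ j y) i z')) ≤ δ b h i j)
    {α₀ : ℝ} (hα₀ : α₀ < 1) (hrowδ : ∀ b h (i : ι b), ∑ j ∈ univ.erase i, δ b h i j ≤ α₀)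
    {ω : ℝ} (hω : ∀ b h (i : ι b) (ξ : (j : ι b) → E b j) (y z : E b i),
      A b h (update ξ i z) - A b h (update ξ i y) ≤ ω)
    {D : (b : ℕ) → (Π i : Iic b, X i) → Λ b → Set ℝ}
    (hD : ∀ b < n, ∀ h η l, affine (m b h) (whiteningFactor (Bm b h)) (e b) η l ∈ D b h l)
    {c : (b : ℕ) → (Π i : Iic b, X i) → Λ b → ℝ}
    (hc : ∀ b < n, ∀ h, LipOn (D b h) (fun ξ => fiberMean κ' (b + 1) φ (succGlue b (h, T b h ξ)))
      (c b h))
    -- (W1′): decay data replacing the row / column sums of the whitening factor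
    (dΛ : (b : ℕ) → Λ b → Λ b → ℝ) (hd_symm : ∀ b (i j : Λ b), dΛ b i j = dΛ b j i)
    (hd_zero : ∀ b (i : Λ b), dΛ b i i = 0)
    (hd_tri : ∀ b (i j k : Λ b), dΛ b i k ≤ dΛ b i j + dΛ b j k)
    {γ κ ρ N βr βc : ℝ} (hργ : ρ < γ) (hκ : 0 ≤ κ)
    (hcoer : ∀ b < n, ∀ h, Coercive ((Bm b h)ᵀ * Bm b h) γ)
    (hMrow : ∀ b < n, ∀ h (i : Λ b),
      ∑ j, |((Bm b h)ᵀ * Bm b h) i j| * (Real.exp (κ * dΛ b i j) - 1) ≤ ρ)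
    (hMcol : ∀ b < n, ∀ h (j : Λ b),
      ∑ i, |((Bm b h)ᵀ * Bm b h) i j| * (Real.exp (κ * dΛ b i j) - 1) ≤ ρ)
    (hN0 : 0 ≤ N) (hN : ∀ b < n, ∀ l : Λ b, ∑ l', Real.exp (-(κ * dΛ b l l')) ≤ N)
    (hβr : 0 ≤ βr) (hBr : ∀ b < n, ∀ h (i : ι b), ∑ l, |Bm b h i l| ≤ βr)
    (hβc : 0 ≤ βc) (hBc : ∀ b < n, ∀ h (l : Λ b), ∑ i, |Bm b h i l| ≤ βc)
    -- measurability / boundedness side conditions and the graded-geometric profile, verbatim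
    (hWm : ∀ b, StronglyMeasurable (fun h => ∑ l, c b h l ^ 2)) {CW : ℝ}
    (hWb : ∀ b h, |∑ l, c b h l ^ 2| ≤ CW)
    (Mf : (b : ℕ) → Finset (Λ b)) {C κ₁ Etot : ℝ} (hκ₁ : 1 ≤ κ₁) {Θ : ℕ → ℝ}
    {J : ℕ → Type*} (Jset : (b : ℕ) → Λ b → Finset (J b))
    {Aev : (b : ℕ) → Λ b → J b → Set (Π i : Iic b, X i)}
    (hA : ∀ b < n, ∀ l ∈ Mf b, ∀ j ∈ Jset b l, MeasurableSet (Aev b l j))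
    (hc0 : ∀ b < n, ∀ h, ∀ l ∉ Mf b, c b h l = 0)
    (hcg : ∀ b < n, ∀ h, ∀ l ∈ Mf b,
      |c b h l| ≤ C * Θ b * κ₁ ^ ((Jset b l).filter fun j => h ∈ Aev b l j).card)
    {ε : (b : ℕ) → Λ b → J b → ℝ} (hε : ∀ b < n, ∀ l ∈ Mf b, ∀ j ∈ Jset b l, 0 ≤ ε b l j)
    (hE : ∀ b < n, ∀ l ∈ Mf b, ∑ j ∈ Jset b l, ε b l j ≤ Etot)
    (hdomA : ∀ b < n, ∀ l ∈ Mf b, ∀ S' ⊆ Jset b l,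
      μ.real (⋂ j ∈ S', {x | frestrictLe b x ∈ Aev b l j}) ≤ μ.real Set.univ * ∏ j ∈ S', ε b l j)
    {P r : ℝ} (hP : 0 ≤ P) (hr0 : 0 ≤ r) (hr1 : r < 1)
    (hgeo : ∀ b, ((Mf b).card : ℝ) * (Θ b ^ 2 * (Real.exp ω * (2 * v + 2 * p b ^ 2))) ≤ P * r ^ b) :
    ∫ x, (φ x - towerMean κ' φ (x 0)) ^ 2 ∂μ ≤
      (1 / (1 - α₀)) * ((1 / 2 : ℝ) * (C ^ 2 * (((γ - ρ)⁻¹ * N * βc) * ((γ - ρ)⁻¹ * N * βr))) *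
        (μ.real Set.univ * Real.exp ((κ₁ ^ 2 - 1) * Etot)) * (P / (1 - r))) := by
  have hK : 0 ≤ (γ - ρ)⁻¹ * N := mul_nonneg (inv_nonneg.mpr (by linarith)) hN0
  have hsums : ∀ b < n, ∀ h,
      (∀ l, ∑ i, |whiteningFactor (Bm b h) l i| ≤ (γ - ρ)⁻¹ * N * βc) ∧
        (∀ i, ∑ l, |whiteningFactor (Bm b h) l i| ≤ (γ - ρ)⁻¹ * N * βr) :=
    fun b hb h => whiteningFactor_sums_le (Bm b h) (dΛ b) hργ hκ (hcoer b hb h) (hd_symm b)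
      (hd_zero b) (hd_tri b) (hMrow b hb h) (hMcol b hb h) hN0 (hN b hb) (hBr b hb h) hβc
      (hBc b hb h)
  exact integral_sq_sub_towerMean_le_of_graded_geometric_whitenedGibbs_boxed_pathLaw μ κ' hκ' n
    hφn hφR hT m (fun b h => whiteningFactor (Bm b h)) he hep π hv0 hv A hAm hAb hrep hδ0 hδ hα₀
    hrowδ hω hD hc (mul_nonneg hK hβc) (mul_nonneg hK hβr) (fun b hb h i => (hsums b hb h).2 i)
    (fun b hb h l => (hsums b hb h).1 l) hWm hWb Mf hκ₁ Jset hA hc0 hcg hε hE hdomA hP hr0 hr1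
    hgeo

end EndToEnd

/-! ## §7 Dictionary: the whitening factor pushes the standard Gaussian forward to the Gaussian
with covariance `(BᵀB)⁻¹` (Mathlib's `multivariateGaussian`) -/

section Gaussian

open WithLp

variable {Λ : Type w} {ι : Type u} [Fintype Λ] [Fintype ι] [DecidableEq Λ] [DecidableEq ι]

omit [DecidableEq ι] in
/-- `[folklore]` The inverse Gram precision is positive semidefinite. -/
theorem posSemidef_inv_transpose_mul_self (B : Matrix ι Λ ℝ) : ((Bᵀ * B)⁻¹).PosSemidef := by
  have h : (Bᴴ * B).PosSemidef := Matrix.posSemidef_conjTranspose_mul_self B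
  have hc : Bᴴ = Bᵀ := by
    ext i j; simp [Matrix.conjTranspose_apply]
  rw [hc] at h
  exact h.inv

/-- `[folklore]` The whitening factor as a continuous linear map between the Euclidean spaces of
whitened and raw configurations. -/
def whiteningCLM (B : Matrix ι Λ ℝ) : EuclideanSpace ℝ ι →L[ℝ] EuclideanSpace ℝ Λ :=
  LinearMap.toContinuousLinearMap (Matrix.toEuclideanLin (whiteningFactor B))

/-- `[folklore]` Unfolding of `whiteningCLM`. -/
theorem whiteningCLM_apply (B : Matrix ι Λ ℝ) (x : EuclideanSpace ℝ ι) :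
    whiteningCLM B x = toLp 2 (whiteningFactor B *ᵥ ofLp x) := rfl

/-- `[folklore]` The adjoint of `whiteningCLM B` is (the Euclidean map of) the transpose. -/
theorem adjoint_whiteningCLM (B : Matrix ι Λ ℝ) :
    (whiteningCLM B).adjoint =
      LinearMap.toContinuousLinearMap (Matrix.toEuclideanLin (whiteningFactor B)ᵀ) := by
  have hc : (whiteningFactor B)ᴴ = (whiteningFactor B)ᵀ := by
    ext i j; simp [Matrix.conjTranspose_apply]
  rw [whiteningCLM, ← LinearMap.adjoint_toContinuousLinearMap, ← hc,
    Matrix.toEuclideanLin_conjTranspose_eq_adjoint]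

/-- `[folklore]` **WHITENING, GAUSSIAN FORM (centred).**  The image of the standard Gaussian on
the whitened configurations `ℝ^ι` under `η ↦ Sη`, `S = (BᵀB)⁻¹Bᵀ`, is the centred Gaussian on
the raw configurations `ℝ^Λ` with covariance matrix `(BᵀB)⁻¹` — by `S Sᵀ = (BᵀB)⁻¹`
(`whiteningFactor_mul_transpose`) and the characterisation of Gaussian measures by mean and
covariance. -/
theorem map_stdGaussian_whiteningCLM (B : Matrix ι Λ ℝ) (h : IsUnit (Bᵀ * B).det) :
    (stdGaussian (EuclideanSpace ℝ ι)).map (whiteningCLM B) =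
      multivariateGaussian 0 (Bᵀ * B)⁻¹ := by
  apply IsGaussian.ext
  · change ∫ x, x ∂_ = ∫ x, x ∂_
    rw [ContinuousLinearMap.integral_id_map IsGaussian.integrable_id, integral_id_stdGaussian,
      map_zero, integral_id_multivariateGaussian]
  · ext u v
    rw [covarianceBilin_map IsGaussian.memLp_two_id, covarianceBilin_stdGaussian,
      innerSL_apply_apply, covarianceBilin_multivariateGaussian (posSemidef_inv_transpose_mul_self B),
      adjoint_whiteningCLM]
    simp only [LinearMap.coe_toContinuousLinearMap']
    rw [Matrix.toLpLin_apply, Matrix.toLpLin_apply, EuclideanSpace.inner_toLp_toLp, star_trivial,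
      dotProduct_comm, Matrix.mulVec_transpose _ (ofLp u), ← Matrix.dotProduct_mulVec,
      Matrix.mulVec_mulVec, whiteningFactor_mul_transpose B h]

/-- `[folklore]` **WHITENING, GAUSSIAN FORM (with mean, on `Λ → ℝ`).**  The PRODUCT of standard
one-dimensional Gaussians on the whitened sites, pushed forward by the affine map
`η ↦ (l ↦ m l + ∑ᵢ S l i ηᵢ)` (= `T4GaussianWhitening.affine m S (fun _ => id)`), is the Gaussian
on the raw sites with mean `m` and covariance `(BᵀB)⁻¹`. -/
theorem map_pi_gaussianReal_affine_whiteningFactor (B : Matrix ι Λ ℝ) (h : IsUnit (Bᵀ * B).det)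
    (m : Λ → ℝ) :
    (Measure.pi fun _ : ι => gaussianReal 0 1).map
        (fun η : ι → ℝ => fun l => m l + ∑ i, whiteningFactor B l i * η i) =
      (multivariateGaussian (toLp 2 m) (Bᵀ * B)⁻¹).map ofLp := by
  -- factor the affine map through the Euclidean spaces
  have hfac : (fun η : ι → ℝ => fun l => m l + ∑ i, whiteningFactor B l i * η i) =
      (ofLp : EuclideanSpace ℝ Λ → Λ → ℝ) ∘ (fun x => toLp 2 m + x) ∘ whiteningCLM B ∘
        (toLp 2 : (ι → ℝ) → EuclideanSpace ℝ ι) := by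
    funext η
    simp only [Function.comp_apply, whiteningCLM_apply, ofLp_add]
    rfl
  -- the translated multivariate Gaussian
  have htrans : (multivariateGaussian (0 : EuclideanSpace ℝ Λ) (Bᵀ * B)⁻¹).map
      (fun x => toLp 2 m + x) = multivariateGaussian (toLp 2 m) (Bᵀ * B)⁻¹ := by
    simp only [multivariateGaussian, zero_add]
    rw [Measure.map_map (measurable_const_add _) (by fun_prop)]
    rfl
  rw [hfac, ← Measure.map_map (by fun_prop) (by fun_prop),
    ← Measure.map_map (by fun_prop) (by fun_prop), ← Measure.map_map (by fun_prop) (by fun_prop),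
    map_pi_eq_stdGaussian, map_stdGaussian_whiteningCLM B h, htrans]

end Gaussian

/-! ## §8 (v1.1) Interactions in whitened coordinates: mixed second differences are
subadditive, and those of a QUADRATIC raw-field functional are explicit

The tensorisation input (W2) of the NE1′ line asks for mixed second differences of the
whitened interaction `A` between distinct whitened sites with row sums `≤ α₀ < 1`.  When the
precision of the Gaussian part is a Gram operator only UP TO an indefinite remainder `Q`
(record (ES-rep-W′) (W0′)), the remainder `½⟨u, Q u⟩` of the raw quadratic form, composed with
the affine reparametrisation `u = affine m S e η`, is carried by `A`; this section shows that its
mixed second differences are EXACTLY `−½ (Δe_j)(Δe_i)((SᵀQS) j i + (SᵀQS) i j)`, hence bounded by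
`2p² (|(SᵀQS) j i| + |(SᵀQS) i j|)` for readings `|e| ≤ p`, with row sums at most
`2p² · s_r s_c · (q_r + q_c)` (`q_r`, `q_c` the row / column sums of `|Q|`), and that the (W2)
format is subadditive in `A` — so such a remainder costs an explicit additive term in `α₀`. -/

section Interaction

variable {Λ : Type w} {ι : Type u} [Fintype Λ] [Fintype ι] [DecidableEq ι] {E : ι → Type v}

omit [Fintype ι] in
/-- `[folklore]` The (W2) format is subadditive: mixed second differences of a sum of two
interactions are bounded by the sum of the bounds. -/
theorem mixedDiff_add_le {A₁ A₂ : ((k : ι) → E k) → ℝ} {δ₁ δ₂ : ι → ι → ℝ}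
    (h₁ : ∀ (i j : ι), j ≠ i → ∀ (ξ : (k : ι) → E k) (y y' : E j) (z z' : E i),
      (A₁ (update (update ξ j y') i z) - A₁ (update (update ξ j y) i z)) -
        (A₁ (update (update ξ j y') i z') - A₁ (update (update ξ j y) i z')) ≤ δ₁ i j)
    (h₂ : ∀ (i j : ι), j ≠ i → ∀ (ξ : (k : ι) → E k) (y y' : E j) (z z' : E i),
      (A₂ (update (update ξ j y') i z) - A₂ (update (update ξ j y) i z)) -
        (A₂ (update (update ξ j y') i z') - A₂ (update (update ξ j y) i z')) ≤ δ₂ i j) :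
    ∀ (i j : ι), j ≠ i → ∀ (ξ : (k : ι) → E k) (y y' : E j) (z z' : E i),
      ((A₁ (update (update ξ j y') i z) + A₂ (update (update ξ j y') i z)) -
          (A₁ (update (update ξ j y) i z) + A₂ (update (update ξ j y) i z))) -
        ((A₁ (update (update ξ j y') i z') + A₂ (update (update ξ j y') i z')) -
          (A₁ (update (update ξ j y) i z') + A₂ (update (update ξ j y) i z'))) ≤
        δ₁ i j + δ₂ i j := by
  intro i j hji ξ y y' z z'
  have := h₁ i j hji ξ y y' z z'
  have := h₂ i j hji ξ y y' z z'
  linarith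

omit [Fintype ι] [DecidableEq ι] in
/-- `[folklore]` Row sums add. -/
theorem rowSum_add_le {δ₁ δ₂ : ι → ι → ℝ} {α₁ α₂ : ℝ} (s : ι → Finset ι)
    (h₁ : ∀ i, ∑ j ∈ s i, δ₁ i j ≤ α₁) (h₂ : ∀ i, ∑ j ∈ s i, δ₂ i j ≤ α₂) (i : ι) :
    ∑ j ∈ s i, (δ₁ i j + δ₂ i j) ≤ α₁ + α₂ := by
  rw [Finset.sum_add_distrib]; exact add_le_add (h₁ i) (h₂ i)

/-- `[folklore]` A quadratic raw-field functional `u ↦ ½ ⟨u, Q u⟩` read in whitened coordinates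
`u = affine m S e η`. -/
def quadInteraction (Q : Matrix Λ Λ ℝ) (m : Λ → ℝ) (S : Matrix Λ ι ℝ) (e : (i : ι) → E i → ℝ)
    (η : (i : ι) → E i) : ℝ :=
  (1 / 2 : ℝ) * (affine m S e η ⬝ᵥ (Q *ᵥ affine m S e η))

omit [Fintype Λ] in
/-- `[folklore]` Changing the whitened site `j` (from `y` to `y'`) before a change at a DIFFERENT
site `i`: the affine image moves by the `j`-th column of `S` times the reading increment. -/
theorem affine_update_update_sub (m : Λ → ℝ) (S : Matrix Λ ι ℝ) (e : (i : ι) → E i → ℝ)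
    {i j : ι} (hji : j ≠ i) (ξ : (k : ι) → E k) (y y' : E j) (z : E i) (l : Λ) :
    affine m S e (update (update ξ j y') i z) l - affine m S e (update (update ξ j y) i z) l =
      S l j * (e j y' - e j y) := by
  rw [affine_update, affine_update, affine_update, affine_update, update_of_ne hji.symm,
    update_of_ne hji.symm]
  ring

omit [Fintype ι] [DecidableEq ι] in
/-- `[folklore]` The second-difference identity of a quadratic form. -/
theorem quadForm_second_diff (Q : Matrix Λ Λ ℝ) (u a b : Λ → ℝ) :
    (u + a + b) ⬝ᵥ (Q *ᵥ (u + a + b)) - (u + a) ⬝ᵥ (Q *ᵥ (u + a)) -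
        (u + b) ⬝ᵥ (Q *ᵥ (u + b)) + u ⬝ᵥ (Q *ᵥ u) =
      a ⬝ᵥ (Q *ᵥ b) + b ⬝ᵥ (Q *ᵥ a) := by
  simp only [Matrix.mulVec_add, add_dotProduct, dotProduct_add]
  ring

omit [Fintype ι] [DecidableEq ι] in
/-- `[folklore]` Columns of `S` paired through `Q` are entries of `SᵀQS`. -/
theorem col_dotProduct_mulVec_col (Q : Matrix Λ Λ ℝ) (S : Matrix Λ ι ℝ) (i j : ι) :
    ((fun l => S l j) ⬝ᵥ (Q *ᵥ fun l => S l i)) = (Sᵀ * Q * S) j i := by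
  simp only [dotProduct, Matrix.mulVec, Matrix.mul_apply, Matrix.transpose_apply,
    Finset.sum_mul, Finset.mul_sum]
  rw [Finset.sum_comm]
  refine Finset.sum_congr rfl fun l' _ => Finset.sum_congr rfl fun l _ => ?_
  ring

/-- `[folklore]` **Mixed second differences of a quadratic interaction, exactly.** -/
theorem mixedDiff_quadInteraction (Q : Matrix Λ Λ ℝ) (m : Λ → ℝ) (S : Matrix Λ ι ℝ)
    (e : (i : ι) → E i → ℝ) {i j : ι} (hji : j ≠ i) (ξ : (k : ι) → E k) (y y' : E j)
    (z z' : E i) :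
    (quadInteraction Q m S e (update (update ξ j y') i z) -
        quadInteraction Q m S e (update (update ξ j y) i z)) -
      (quadInteraction Q m S e (update (update ξ j y') i z') -
        quadInteraction Q m S e (update (update ξ j y) i z')) =
      -((1 / 2 : ℝ) * ((e j y' - e j y) * (e i z' - e i z)) *
        ((Sᵀ * Q * S) j i + (Sᵀ * Q * S) i j)) := by
  -- the four raw configurations are u, u + a, u + b, u + a + b
  set u := affine m S e (update (update ξ j y) i z) with hu
  set a : Λ → ℝ := fun l => S l j * (e j y' - e j y) with ha
  set b : Λ → ℝ := fun l => S l i * (e i z' - e i z) with hb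
  have h1 : affine m S e (update (update ξ j y') i z) = u + a := by
    funext l
    have := affine_update_update_sub m S e hji ξ y y' z l
    simp only [hu, ha, Pi.add_apply]; linarith
  have h2 : affine m S e (update (update ξ j y) i z') = u + b := by
    funext l
    have := affine_update m S e (update (update ξ j y) i z) i z' l
    rw [update_idem, update_self] at this
    simp only [hu, hb, Pi.add_apply]; linarith
  have h3 : affine m S e (update (update ξ j y') i z') = u + a + b := by
    funext l
    have h3a := affine_update m S e (update (update ξ j y') i z) i z' l
    rw [update_idem, update_self] at h3a
    have h3b := affine_update_update_sub m S e hji ξ y y' z l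
    simp only [hu, ha, hb, Pi.add_apply]; linarith
  simp only [quadInteraction, h1, h2, h3]
  have hq := quadForm_second_diff Q u a b
  have hab : a ⬝ᵥ (Q *ᵥ b) = (e j y' - e j y) * (e i z' - e i z) * (Sᵀ * Q * S) j i := by
    rw [← col_dotProduct_mulVec_col]
    simp only [ha, hb, dotProduct, Matrix.mulVec, Finset.mul_sum]
    refine Finset.sum_congr rfl fun l _ => Finset.sum_congr rfl fun l' _ => ?_
    ring
  have hba : b ⬝ᵥ (Q *ᵥ a) = (e j y' - e j y) * (e i z' - e i z) * (Sᵀ * Q * S) i j := by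
    rw [← col_dotProduct_mulVec_col]
    simp only [ha, hb, dotProduct, Matrix.mulVec, Finset.mul_sum]
    refine Finset.sum_congr rfl fun l _ => Finset.sum_congr rfl fun l' _ => ?_
    ring
  rw [hab, hba] at hq
  linarith

/-- `[folklore]` **The (W2)-format bound for a quadratic interaction** with readings `|e| ≤ p`:
mixed second differences `≤ 2p² (|(SᵀQS) j i| + |(SᵀQS) i j|)`. -/
theorem mixedDiff_quadInteraction_le (Q : Matrix Λ Λ ℝ) (m : Λ → ℝ) (S : Matrix Λ ι ℝ)
    (e : (i : ι) → E i → ℝ) {p : ℝ} (hep : ∀ i x, |e i x| ≤ p) :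
    ∀ (i j : ι), j ≠ i → ∀ (ξ : (k : ι) → E k) (y y' : E j) (z z' : E i),
      (quadInteraction Q m S e (update (update ξ j y') i z) -
          quadInteraction Q m S e (update (update ξ j y) i z)) -
        (quadInteraction Q m S e (update (update ξ j y') i z') -
          quadInteraction Q m S e (update (update ξ j y) i z')) ≤
        2 * p ^ 2 * (|(Sᵀ * Q * S) j i| + |(Sᵀ * Q * S) i j|) := by
  intro i j hji ξ y y' z z'
  rw [mixedDiff_quadInteraction Q m S e hji]
  have hα : |e j y' - e j y| ≤ 2 * p := by
    have := abs_sub (e j y') (e j y); have := hep j y'; have := hep j y; linarith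
  have hβ : |e i z' - e i z| ≤ 2 * p := by
    have := abs_sub (e i z') (e i z); have := hep i z'; have := hep i z; linarith
  have hp : 0 ≤ p := (abs_nonneg _).trans (hep i z)
  have hprod : |(e j y' - e j y) * (e i z' - e i z)| ≤ 2 * p * (2 * p) := by
    rw [abs_mul]; exact mul_le_mul hα hβ (abs_nonneg _) (by linarith)
  calc -((1 / 2 : ℝ) * ((e j y' - e j y) * (e i z' - e i z)) *
          ((Sᵀ * Q * S) j i + (Sᵀ * Q * S) i j))
      ≤ |(1 / 2 : ℝ) * ((e j y' - e j y) * (e i z' - e i z)) *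
          ((Sᵀ * Q * S) j i + (Sᵀ * Q * S) i j)| := neg_le_abs _
    _ = (1 / 2 : ℝ) * |(e j y' - e j y) * (e i z' - e i z)| *
          |(Sᵀ * Q * S) j i + (Sᵀ * Q * S) i j| := by
        rw [abs_mul, abs_mul, abs_of_pos (by norm_num : (0 : ℝ) < 1 / 2)]
    _ ≤ (1 / 2 : ℝ) * (2 * p * (2 * p)) * (|(Sᵀ * Q * S) j i| + |(Sᵀ * Q * S) i j|) := by
        gcongr
        exact abs_add_le _ _
    _ = 2 * p ^ 2 * (|(Sᵀ * Q * S) j i| + |(Sᵀ * Q * S) i j|) := by ring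

/-- `[folklore]` **Row sums of the quadratic bound**: `∑_{j ≠ i} 2p² (|(SᵀQS) j i| + |(SᵀQS) i j|)
≤ 2p² · s_r s_c · (q_r + q_c)` from the row sums `s_r` / column sums `s_c` of `|S|` and the row
sums `q_r` / column sums `q_c` of `|Q|` (§1) — the explicit additive cost in `α₀` of a quadratic
remainder carried by the interaction. -/
theorem rowSum_quadInteraction_le (Q : Matrix Λ Λ ℝ) (S : Matrix Λ ι ℝ) {p sr sc qr qc : ℝ}
    (hsr : 0 ≤ sr) (hqr : 0 ≤ qr) (hqc : 0 ≤ qc)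
    (hrow : ∀ l, ∑ i, |S l i| ≤ sr) (hcol : ∀ i, ∑ l, |S l i| ≤ sc)
    (hQr : ∀ l, ∑ l', |Q l l'| ≤ qr) (hQc : ∀ l', ∑ l, |Q l l'| ≤ qc) (i : ι) :
    ∑ j ∈ univ.erase i, 2 * p ^ 2 * (|(Sᵀ * Q * S) j i| + |(Sᵀ * Q * S) i j|) ≤
      2 * p ^ 2 * (sr * sc * (qr + qc)) := by
  have hT1 : ∀ i, ∑ l, |Sᵀ i l| ≤ sc := fun i => by rw [sum_abs_transpose_apply]; exact hcol i
  have hT2 : ∀ l, ∑ i, |Sᵀ i l| ≤ sr := fun l => by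
    simp only [Matrix.transpose_apply]; exact hrow l
  have hrowS : ∀ l, ∑ j, |(Sᵀ * Q * S) l j| ≤ sc * qr * sr := fun l =>
    rowSum_mul_le (Sᵀ * Q) S hsr (fun i' => rowSum_mul_le Sᵀ Q hqr hT1 hQr i') hrow l
  have hcolS : ∀ j, ∑ l, |(Sᵀ * Q * S) l j| ≤ sr * qc * sc := fun j =>
    colSum_mul_le (Sᵀ * Q) S (mul_nonneg hsr hqc) (fun l' => colSum_mul_le Sᵀ Q hsr hT2 hQc l')
      hcol j
  have h2p : 0 ≤ 2 * p ^ 2 := by positivity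
  calc ∑ j ∈ univ.erase i, 2 * p ^ 2 * (|(Sᵀ * Q * S) j i| + |(Sᵀ * Q * S) i j|)
      ≤ ∑ j, 2 * p ^ 2 * (|(Sᵀ * Q * S) j i| + |(Sᵀ * Q * S) i j|) :=
        Finset.sum_le_sum_of_subset_of_nonneg (Finset.erase_subset _ _)
          fun j _ _ => mul_nonneg h2p (add_nonneg (abs_nonneg _) (abs_nonneg _))
    _ = 2 * p ^ 2 * (∑ j, |(Sᵀ * Q * S) j i| + ∑ j, |(Sᵀ * Q * S) i j|) := by
        rw [← Finset.mul_sum, Finset.sum_add_distrib]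
    _ ≤ 2 * p ^ 2 * (sr * qc * sc + sc * qr * sr) := by
        gcongr
        · exact hcolS i
        · exact hrowS i
    _ = 2 * p ^ 2 * (sr * sc * (qr + qc)) := by ring

end Interaction

end Literature.MathematicalPhysics.QuantumFieldTheory.Balaban1983to89.T4WhiteningFactor
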